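import Mathlib.Algebra.BigOperators.Ring.Finset
import Literature.MathematicalPhysics.QuantumFieldTheory.Dimock2011to13.QED3TwoSpeciesKernels
import HarnessLib

/-!
# Dimock–Yuan, *Structural stability of the RG flow in the Gross–Neveu model*, §2.3 LEMMA 9: the translated
# element `F⁺(ψ,η) = F(ψ + η)` has `‖F⁺‖_{h,h′} = ‖F‖_{h+h′}` (120) — PROVED on finite sets of generators, with the
# two-parameter norm `‖·‖_{h,h′}` (112) and the multiplied-out product `Π(ψ(ξ_i)+η(ξ_i))` (121)

statement-level skeleton of published theorems with citation tags; proofs where landed; nothing here is a claim about the Yang–Mills mass gap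

**Citation header (reproduction of PUBLISHED work).** J. Dimock, C. Yuan, *Structural stability of the RG flow in the
Gross–Neveu model*, Ann. Henri Poincaré **25** (2024) 5113–5186 = arXiv:2303.07916 [DimockYuan2024GNFlow], §2.3:
the norm `‖F‖_{h,h′}` (112) p.18 L28–33 and **LEMMA 9** (120) with its proof (121)–(123), p.19 L20–80 of the arXiv text
layer `paper:arxiv-2303.07916`. Writer seat p11 (literature-prover-lit-balaban-p11-g15-0), YM LIT SWEEP item (c) D10.

**The printed text.** (112): *"Suppose the Grassmann algebra has two sets of generators `ψ, ψ̄` and `η, η̄` … The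
associated norm is `‖F‖_{h,h′} = Σ_{n=m,n′=m′} (h^{n+m}h′^{n′+m′}/(n!m!n′!m′!)) ‖F_{nm,n′m′}‖_{C′}`"*. LEMMA 9 (p.19 L20–22):
*"The following result is also useful. Lemma 9. If `F⁺(ψ,η) = F(ψ+η)` then `‖F⁺‖_{h,h′} = ‖F‖_{h+h′}` (120). Proof. We
use the representation (21) which does not distinguish `ψ, ψ̄`. Then we have `F⁺(ψ,η) = Σ_ℓ (1/ℓ!) ∫ F_ℓ(ξ₁,…,ξ_ℓ)
(ψ(ξ₁)+η(ξ₁))⋯(ψ(ξ_ℓ)+η(ξ_ℓ)) dξ = … = Σ_{n,m} (1/(n!m!)) ∫ F_{n+m}(ξ₁,…,ξ_n,ζ₁,…,ζ_m) ψ(ξ₁)⋯ψ(ξ_n)η(ζ₁)⋯η(ζ_m)`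
(121) Here in the first line we multiply out the product and in each of the `2^ℓ` terms and move all the `ψ(ξ_i)` to
the left. Make the same permutation in the kernel and the signs cancel. … There are `ℓ!/n!m!` of these corresponding
to the number of start positions. … `F⁺_{n,m}(ξ₁,…,ξ_n,ζ₁,…,ζ_m) = F_{n+m}(ξ₁,…,ξ_n,ζ₁,…,ζ_m)` (122) Hence `‖F⁺‖_{h,h′}
= Σ_{n,m} (h^n h′^m/(n!m!)) ‖F_{n+m}‖ = Σ_ℓ (1/ℓ!) …`"* (123).

**Lean rendering (finite sets of generators).** The paper's algebras are generated by fields on a torus with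
distributional kernels; here, as in the sibling files of the D12 Appendix-B cluster (`Dimock2011to13/QED3FermionNorm`,
`…/QED3TwoSpeciesKernels`, `…/QED3FermionPartialIntegral`), the generators form a finite linearly ordered set `ι`
(all letters `ξ = (x, ω)`, *"which does not distinguish `ψ, ψ̄`"*), the doubled algebra is `Λ(ι ⊕ₗ ι)` (the `ψ`-copy
before the `η`-copy), and norms are the `ℓ¹`-type monomial-basis norms of those files:
* **`hNorm₂ h h′ F = Σ_S h^{#S₁} h′^{#S₂} |c_S(F)|`** — (112) for two blocks `ι₁, ι₂`; `hNorm₂_eq_kernels` (its printed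
  kernel form `Σ h^n h′^m/(n!m!) ‖f_{n,m}‖₁` with the kernels `kernel₂` of `QED3TwoSpeciesKernels.lean`), `hNorm₂_self`
  (`‖F‖_{h,h} = ‖F‖_h`);
* **`shift F`** (= `F⁺`) — the algebra homomorphism `ψ(ξ) ↦ ψ(ξ) + η(ξ)` (`shift_gen`), i.e. `ExteriorAlgebra.map` of
  `v ↦ v ∘ fold`;
* **`shift_grassmannBasis`** — (121): `F⁺(θ_S) = Σ_{A⊆S} (−1)^{splitSign S A} ψ(A)η(S∖A)` (`split S A` the letters,
  `splitSign S A = #{(ξ,ζ) ∈ A × (S∖A) : ζ < ξ}` the transpositions moving the `ψ`'s to the left), by induction on the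
  smallest letter (`gen_inl_mul_split`, `gen_inr_mul_split`, `splitSign_insert_insert`, `splitSign_insert`);
* **`coeff_shift`**, `norm_coeff_shift` — (122) in the monomial basis: `c_T(F⁺) = ±c_{A∪B}(F)` for `T = ψ(A)η(B)` with
  `A ∩ B = ∅`, else `0`;
* **`hNorm₂_shift` — LEMMA 9 (120)**: `‖F⁺‖_{h,h′} = ‖F‖_{h+h′}`, the count (123) being the binomial theorem
  `Σ_{A⊆S} h^{#A}h′^{#S−#A} = (h+h′)^{#S}` (Mathlib `Finset.sum_pow_mul_eq_add_pow`).
No named facts, no `sorry`.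
-/

noncomputable section

open Finset

namespace Literature.MathematicalPhysics.QuantumFieldTheory.DimockYuan2024

namespace FieldTranslationNorm

open Literature.MathematicalPhysics.QuantumLattice
open Literature.MathematicalPhysics.QuantumLattice.GrassmannAlgebra
open Literature.MathematicalPhysics.QuantumFieldTheory.Dimock2011to13.QED3TorusI

variable {𝕜 : Type*} [RCLike 𝕜]

/-! ## The two-parameter norm `‖F‖_{h,h′}` (112) -/

section TwoParam

variable {ι₁ ι₂ : Type*} [LinearOrder ι₁] [Fintype ι₁] [LinearOrder ι₂] [Fintype ι₂]

/-- **The two-parameter norm `‖F‖_{h,h′}`** (112) on the algebra generated by two blocks of fields (`ψ,ψ̄` ↔ `ι₁`, weight `h`;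
`η,η̄` ↔ `ι₂`, weight `h′`), in the monomial basis: `Σ_S h^{#S₁} h′^{#S₂} |c_S(F)|` (its printed kernel form is `hNorm₂_eq_kernels`). [cite: DimockYuan2024GNFlow, §2.3 (112) p.18 L28–33] -/
def hNorm₂ (h h' : ℝ) (F : GrassmannAlgebra 𝕜 (ι₁ ⊕ₗ ι₂)) : ℝ :=
  ∑ S : Finset (ι₁ ⊕ₗ ι₂), h ^ (fstPart S).card * h' ^ (sndPart S).card * ‖coeff F S‖

/-- `‖F‖_{h,h} = ‖F‖_h` (the one-parameter norm `hNorm` of `QED3FermionNorm.lean`). [cite: DimockYuan2024GNFlow, §2.3 (112) p.18 L28–33] -/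
theorem hNorm₂_self (h : ℝ) (F : GrassmannAlgebra 𝕜 (ι₁ ⊕ₗ ι₂)) : hNorm₂ h h F = hNorm h F := by
  unfold hNorm₂ hNorm
  refine Finset.sum_congr rfl fun S _ => ?_
  rw [← pow_add, card_fstPart_add_card_sndPart]

/-- `‖F‖_{h,h′} ≥ 0`. [cite: DimockYuan2024GNFlow, §2.3 (112) p.18 L28–33] -/
theorem hNorm₂_nonneg {h h' : ℝ} (hh : 0 ≤ h) (hh' : 0 ≤ h') (F : GrassmannAlgebra 𝕜 (ι₁ ⊕ₗ ι₂)) :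
    0 ≤ hNorm₂ h h' F :=
  Finset.sum_nonneg fun _ _ => mul_nonneg (mul_nonneg (pow_nonneg hh _) (pow_nonneg hh' _)) (norm_nonneg _)

/-- Summing over the two-species types `(n,m)` is summing over all sets of generators (as in `QED3TwoSpeciesKernels.lean`). [folklore] -/
private theorem sum_ofType' {M : Type*} [AddCommMonoid M] (g : Finset (ι₁ ⊕ₗ ι₂) → M) :
    ∑ n ∈ range (Fintype.card ι₁ + 1), ∑ m ∈ range (Fintype.card ι₂ + 1), ∑ S ∈ ofType n m, g S = ∑ S, g S := by
  classical
  have h1 : ∀ n : ℕ, ∑ m ∈ range (Fintype.card ι₂ + 1), ∑ S ∈ ofType n m, g S =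
      ∑ S ∈ univ.filter (fun S : Finset (ι₁ ⊕ₗ ι₂) => (fstPart S).card = n), g S := by
    intro n
    rw [← Finset.sum_fiberwise_of_maps_to (s := univ.filter fun S : Finset (ι₁ ⊕ₗ ι₂) => (fstPart S).card = n)
      (t := range (Fintype.card ι₂ + 1)) (g := fun S => (sndPart S).card)
      (fun S _ => mem_range.2 (Nat.lt_succ_of_le (card_le_univ _)))]
    refine Finset.sum_congr rfl fun m _ => ?_
    rw [Finset.filter_filter]
  simp only [h1]
  exact Finset.sum_fiberwise_of_maps_to (fun S _ => mem_range.2 (Nat.lt_succ_of_le (card_le_univ _))) _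

/-- **(112) in kernel form**: `‖F‖_{h,h′} = Σ_{n ≤ |ι₁|, m ≤ |ι₂|} (h^n h′^m/(n!m!)) ‖f_{n,m}‖₁` with the separately antisymmetric kernels
`f_{n,m} = kernel₂ F n m` of `QED3TwoSpeciesKernels.lean` (the printed `Σ h^{n+m}h′^{n′+m′}/(n!m!n′!m′!) ‖F_{nm,n′m′}‖` groups the `ψ,ψ̄`
letters in the first block and the `η,η̄` letters in the second). [cite: DimockYuan2024GNFlow, §2.3 (112) p.18 L28–33] -/
theorem hNorm₂_eq_kernels (h h' : ℝ) (F : GrassmannAlgebra 𝕜 (ι₁ ⊕ₗ ι₂)) :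
    hNorm₂ h h' F = ∑ n ∈ range (Fintype.card ι₁ + 1), ∑ m ∈ range (Fintype.card ι₂ + 1),
      h ^ n * h' ^ m / ((n.factorial : ℝ) * m.factorial) *
        ∑ x : Fin n → ι₁, ∑ y : Fin m → ι₂, ‖kernel₂ F n m x y‖ := by
  classical
  simp only [sum_norm_kernel₂]
  have hfac : ∀ n m : ℕ, h ^ n * h' ^ m / ((n.factorial : ℝ) * m.factorial) *
      (((n.factorial * m.factorial : ℕ) : ℝ) * ∑ S ∈ ofType n m, ‖coeff F S‖) =
      ∑ S ∈ (ofType n m : Finset (Finset (ι₁ ⊕ₗ ι₂))), h ^ (fstPart S).card * h' ^ (sndPart S).card * ‖coeff F S‖ := by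
    intro n m
    rw [← mul_assoc, Nat.cast_mul, div_mul_cancel₀ _ (mul_ne_zero (Nat.cast_ne_zero.2 (Nat.factorial_ne_zero n))
      (Nat.cast_ne_zero.2 (Nat.factorial_ne_zero m))), Finset.mul_sum]
    refine Finset.sum_congr rfl fun S hS => ?_
    obtain ⟨hn, hm⟩ := (mem_filter.1 hS).2
    rw [hn, hm]
  simp only [hfac]
  rw [sum_ofType']
  rfl

end TwoParam

/-! ## The translation `F⁺(ψ,η) = F(ψ + η)` -/

variable {ι : Type*} [LinearOrder ι] [Fintype ι]

section Expansion

/-- Both copies of a letter `ξ` name the same argument of `F`: `(ψ+η)(ξ)`. [cite: DimockYuan2024GNFlow, §2.3 Lemma 9 (120) p.19 L20–22] -/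
def fold (w : ι ⊕ₗ ι) : ι := Sum.elim id id (ofLex w)

omit [LinearOrder ι] [Fintype ι] in
/-- Unfolding. [folklore] -/
@[simp] private theorem fold_inl (i : ι) : fold (toLex (Sum.inl i) : ι ⊕ₗ ι) = i := rfl

omit [LinearOrder ι] [Fintype ι] in
/-- Unfolding. [folklore] -/
@[simp] private theorem fold_inr (i : ι) : fold (toLex (Sum.inr i) : ι ⊕ₗ ι) = i := rfl

/-- **`F⁺(ψ,η) = F(ψ + η)`**: the algebra homomorphism `Λ(ι) → Λ(ι ⊕ₗ ι)` substituting `ψ(ξ) ↦ ψ(ξ) + η(ξ)` (`shift_gen`). [cite: DimockYuan2024GNFlow, §2.3 Lemma 9 (120) p.19 L20–22] -/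
def shift : GrassmannAlgebra 𝕜 ι →ₐ[𝕜] GrassmannAlgebra 𝕜 (ι ⊕ₗ ι) :=
  ExteriorAlgebra.map (LinearMap.funLeft 𝕜 𝕜 (fold : ι ⊕ₗ ι → ι))

omit [Fintype ι] in
/-- The substitution on coordinate vectors: `e_ξ ↦ e_{(0,ξ)} + e_{(1,ξ)}`. [folklore] -/
private theorem funLeft_fold_single (i : ι) :
    LinearMap.funLeft 𝕜 𝕜 (fold : ι ⊕ₗ ι → ι) (Pi.single i 1) =
      Pi.single (toLex (Sum.inl i) : ι ⊕ₗ ι) 1 + Pi.single (toLex (Sum.inr i)) 1 := by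
  ext w
  rw [LinearMap.funLeft_apply, Pi.add_apply]
  obtain ⟨w, rfl⟩ := toLex.surjective w
  rcases w with j | j
  · rw [fold_inl]
    by_cases hij : j = i
    · subst hij; simp
    · rw [Pi.single_eq_of_ne hij, Pi.single_eq_of_ne (by simpa using hij), Pi.single_eq_of_ne (by simp), add_zero]
  · rw [fold_inr]
    by_cases hij : j = i
    · subst hij; simp
    · rw [Pi.single_eq_of_ne hij, Pi.single_eq_of_ne (by simp), Pi.single_eq_of_ne (by simpa using hij), add_zero]

omit [Fintype ι] in
/-- `F⁺` on a field: `ψ(ξ) ↦ ψ(ξ) + η(ξ)`. [cite: DimockYuan2024GNFlow, §2.3 Lemma 9 (120) p.19 L20–22] -/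
theorem shift_gen (i : ι) :
    shift (𝕜 := 𝕜) (gen 𝕜 i) = gen 𝕜 (toLex (Sum.inl i) : ι ⊕ₗ ι) + gen 𝕜 (toLex (Sum.inr i)) := by
  rw [shift, gen, ExteriorAlgebra.map_apply_ι, funLeft_fold_single, map_add, gen, gen]

/-- The monomial `ψ(A) η(S ∖ A)` of the multiplied-out product `Π_{ξ∈S} (ψ(ξ) + η(ξ))`: `ψ` chosen on `A`, `η` on `S ∖ A`. [cite: DimockYuan2024GNFlow, §2.3 Lemma 9, proof (121) p.19 L23–62] -/
def split (S A : Finset ι) : Finset (ι ⊕ₗ ι) :=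
  A.map (inlEmb : ι ↪o ι ⊕ₗ ι).toEmbedding ∪ (S \ A).map (inrEmb : ι ↪o ι ⊕ₗ ι).toEmbedding

/-- The number of transpositions moving *"all the `ψ(ξ_i)` to the left"* in the term `A` of `Π_{ξ∈S}(ψ(ξ)+η(ξ))`: the pairs
`(ξ, ζ) ∈ A × (S ∖ A)` with `ζ < ξ` (an `η(ζ)` standing left of a `ψ(ξ)`). [cite: DimockYuan2024GNFlow, §2.3 Lemma 9, proof (121) p.19 L23–62] -/
def splitSign (S A : Finset ι) : ℕ := ((A ×ˢ (S \ A)).filter fun p => p.2 < p.1).card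

omit [Fintype ι] in
/-- Membership in `split S A`. [folklore] -/
private theorem mem_split {S A : Finset ι} {w : ι ⊕ₗ ι} :
    w ∈ split S A ↔ (∃ a ∈ A, toLex (Sum.inl a) = w) ∨ ∃ b ∈ S \ A, toLex (Sum.inr b) = w := by
  simp [split, Finset.mem_map]

/-- The creation-operator action `θₐ θ_w = (−1)^{#{b ∈ w | b < a}} θ_{w ∪ {a}}` of `QuantumLattice.GrassmannIntegralPartial`,
restated on the letters of `ι ⊕ₗ ι` (same statement; this copy carries the instances elaborated in this file). [folklore] -/
private theorem gen_mul_grassmannBasis_of_not_mem' {a : ι ⊕ₗ ι} {w : Finset (ι ⊕ₗ ι)} (ha : a ∉ w) :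
    gen 𝕜 a * grassmannBasis 𝕜 (ι ⊕ₗ ι) w =
      ((-1 : 𝕜) ^ (w.filter (· < a)).card) • grassmannBasis 𝕜 (ι ⊕ₗ ι) (insert a w) :=
  gen_mul_grassmannBasis_of_not_mem 𝕜 ha

/-- `ψ(a)·ψ(A)η(S∖A) = ψ(insert a A) η(S∖A)` for a new smallest letter `a` (no sign). [cite: DimockYuan2024GNFlow, §2.3 Lemma 9, proof (121) p.19 L23–62] -/
theorem gen_inl_mul_split {a : ι} {S A : Finset ι} (hA : A ⊆ S) (hmin : ∀ x ∈ S, a < x) :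
    gen 𝕜 (toLex (Sum.inl a) : ι ⊕ₗ ι) * grassmannBasis 𝕜 (ι ⊕ₗ ι) (split S A) =
      grassmannBasis 𝕜 (ι ⊕ₗ ι) (split (insert a S) (insert a A)) := by
  classical
  have haS : a ∉ S := fun h => lt_irrefl a (hmin a h)
  have hnot : (toLex (Sum.inl a) : ι ⊕ₗ ι) ∉ split S A := by
    rw [mem_split]
    rintro (⟨x, hx, hxe⟩ | ⟨y, _, hye⟩)
    · have : x = a := by simpa using hxe
      subst this
      exact haS (hA hx)
    · simp at hye
  rw [gen_mul_grassmannBasis_of_not_mem' hnot]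
  have hfilter : ((split S A).filter fun w => w < toLex (Sum.inl a)) = ∅ := by
    refine Finset.filter_eq_empty_iff.2 fun w hw => ?_
    rw [mem_split] at hw
    rcases hw with ⟨x, hx, rfl⟩ | ⟨y, hy, rfl⟩
    · exact not_lt.2 (Sum.Lex.inl_le_inl_iff.2 (hmin x (hA hx)).le)
    · exact Sum.Lex.not_inr_lt_inl
  have hsd : insert a S \ insert a A = S \ A := by
    ext x
    simp only [Finset.mem_sdiff, Finset.mem_insert]
    constructor
    · rintro ⟨h1, h2⟩
      push Not at h2
      exact ⟨h1.resolve_left h2.1, h2.2⟩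
    · rintro ⟨h1, h2⟩
      exact ⟨Or.inr h1, fun h => h.elim (fun h' => haS (h' ▸ h1)) h2⟩
  have hset : insert (toLex (Sum.inl a)) (split S A) = split (insert a S) (insert a A) := by
    ext w
    rw [Finset.mem_insert, mem_split, mem_split, hsd]
    constructor
    · rintro (rfl | ⟨x, hx, rfl⟩ | ⟨y, hy, rfl⟩)
      · exact Or.inl ⟨a, Finset.mem_insert_self a A, rfl⟩
      · exact Or.inl ⟨x, Finset.mem_insert_of_mem hx, rfl⟩
      · exact Or.inr ⟨y, hy, rfl⟩
    · rintro (⟨x, hx, rfl⟩ | ⟨y, hy, rfl⟩)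
      · rcases Finset.mem_insert.1 hx with rfl | hx
        · exact Or.inl rfl
        · exact Or.inr (Or.inl ⟨x, hx, rfl⟩)
      · exact Or.inr (Or.inr ⟨y, hy, rfl⟩)
  rw [hfilter, Finset.card_empty, pow_zero, one_smul, hset]

/-- `η(a)·ψ(A)η(S∖A) = (−1)^{#A} ψ(A) η(insert a (S∖A))` for a new smallest letter `a` (`η(a)` passes the `#A` fields `ψ`). [cite: DimockYuan2024GNFlow, §2.3 Lemma 9, proof (121) p.19 L23–62] -/
theorem gen_inr_mul_split {a : ι} {S A : Finset ι} (hA : A ⊆ S) (hmin : ∀ x ∈ S, a < x) :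
    gen 𝕜 (toLex (Sum.inr a) : ι ⊕ₗ ι) * grassmannBasis 𝕜 (ι ⊕ₗ ι) (split S A) =
      ((-1 : 𝕜) ^ A.card) • grassmannBasis 𝕜 (ι ⊕ₗ ι) (split (insert a S) A) := by
  classical
  have haS : a ∉ S := fun h => lt_irrefl a (hmin a h)
  have hnot : (toLex (Sum.inr a) : ι ⊕ₗ ι) ∉ split S A := by
    rw [mem_split]
    rintro (⟨x, _, hxe⟩ | ⟨y, hy, hye⟩)
    · simp at hxe
    · have : y = a := by simpa using hye
      subst this
      exact haS (Finset.mem_sdiff.1 hy).1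
  rw [gen_mul_grassmannBasis_of_not_mem' hnot]
  have hfilter : ((split S A).filter fun w => w < toLex (Sum.inr a)) =
      A.map (inlEmb : ι ↪o ι ⊕ₗ ι).toEmbedding := by
    ext w
    rw [Finset.mem_filter, mem_split, Finset.mem_map]
    constructor
    · rintro ⟨hw | ⟨y, hy, rfl⟩, hlt⟩
      · obtain ⟨x, hx, rfl⟩ := hw
        exact ⟨x, hx, rfl⟩
      · exfalso
        have := Sum.Lex.inr_lt_inr_iff.1 hlt
        exact lt_asymm this (hmin y (Finset.mem_sdiff.1 hy).1)
    · rintro ⟨x, hx, rfl⟩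
      exact ⟨Or.inl ⟨x, hx, rfl⟩, Sum.Lex.inl_lt_inr _ _⟩
  have hsd : insert a S \ A = insert a (S \ A) := by
    ext x
    simp only [Finset.mem_sdiff, Finset.mem_insert]
    constructor
    · rintro ⟨rfl | h1, h2⟩
      · exact Or.inl rfl
      · exact Or.inr ⟨h1, h2⟩
    · rintro (rfl | ⟨h1, h2⟩)
      · exact ⟨Or.inl rfl, fun h => haS (hA h)⟩
      · exact ⟨Or.inr h1, h2⟩
  have hset : insert (toLex (Sum.inr a)) (split S A) = split (insert a S) A := by
    ext w
    rw [Finset.mem_insert, mem_split, mem_split, hsd]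
    constructor
    · rintro (rfl | ⟨x, hx, rfl⟩ | ⟨y, hy, rfl⟩)
      · exact Or.inr ⟨a, Finset.mem_insert_self a _, rfl⟩
      · exact Or.inl ⟨x, hx, rfl⟩
      · exact Or.inr ⟨y, Finset.mem_insert_of_mem hy, rfl⟩
    · rintro (⟨x, hx, rfl⟩ | ⟨y, hy, rfl⟩)
      · exact Or.inr (Or.inl ⟨x, hx, rfl⟩)
      · rcases Finset.mem_insert.1 hy with rfl | hy
        · exact Or.inl rfl
        · exact Or.inr (Or.inr ⟨y, hy, rfl⟩)
  rw [hfilter, Finset.card_map, hset]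

omit [Fintype ι] in
/-- Sign bookkeeping: choosing `ψ(a)` for a new smallest `a` creates no transposition. [cite: DimockYuan2024GNFlow, §2.3 Lemma 9, proof (121) p.19 L23–62] -/
theorem splitSign_insert_insert {a : ι} {S A : Finset ι} (hA : A ⊆ S) (hmin : ∀ x ∈ S, a < x) :
    splitSign (insert a S) (insert a A) = splitSign S A := by
  classical
  have haS : a ∉ S := fun h => lt_irrefl a (hmin a h)
  have hsd : insert a S \ insert a A = S \ A := by
    ext x
    simp only [Finset.mem_sdiff, Finset.mem_insert]
    constructor
    · rintro ⟨h1, h2⟩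
      push Not at h2
      exact ⟨h1.resolve_left h2.1, h2.2⟩
    · rintro ⟨h1, h2⟩
      exact ⟨Or.inr h1, fun h => h.elim (fun h' => haS (h' ▸ h1)) h2⟩
  unfold splitSign
  rw [hsd, Finset.insert_eq, Finset.union_product, Finset.filter_union, Finset.card_union_of_disjoint]
  · have h0 : (({a} ×ˢ (S \ A)).filter fun p : ι × ι => p.2 < p.1) = ∅ := by
      refine Finset.filter_eq_empty_iff.2 fun p hp => ?_
      obtain ⟨h1, h2⟩ := Finset.mem_product.1 hp
      rw [Finset.mem_singleton] at h1
      rw [h1]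
      exact not_lt.2 (hmin p.2 (Finset.mem_sdiff.1 h2).1).le
    rw [h0, Finset.card_empty, zero_add]
  · exact Finset.disjoint_filter_filter
      (Finset.disjoint_product.2 (Or.inl (Finset.disjoint_singleton_left.2 (fun h => haS (hA h)))))

omit [Fintype ι] in
/-- Sign bookkeeping: choosing `η(a)` for a new smallest `a` creates `#A` transpositions. [cite: DimockYuan2024GNFlow, §2.3 Lemma 9, proof (121) p.19 L23–62] -/
theorem splitSign_insert {a : ι} {S A : Finset ι} (hA : A ⊆ S) (hmin : ∀ x ∈ S, a < x) :
    splitSign (insert a S) A = splitSign S A + A.card := by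
  classical
  have haS : a ∉ S := fun h => lt_irrefl a (hmin a h)
  have hsd : insert a S \ A = insert a (S \ A) := by
    ext x
    simp only [Finset.mem_sdiff, Finset.mem_insert]
    constructor
    · rintro ⟨rfl | h1, h2⟩
      · exact Or.inl rfl
      · exact Or.inr ⟨h1, h2⟩
    · rintro (rfl | ⟨h1, h2⟩)
      · exact ⟨Or.inl rfl, fun h => haS (hA h)⟩
      · exact ⟨Or.inr h1, h2⟩
  unfold splitSign
  rw [hsd, Finset.insert_eq, Finset.product_union, Finset.filter_union, Finset.card_union_of_disjoint, add_comm]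
  · congr 1
    have h1 : ((A ×ˢ ({a} : Finset ι)).filter fun p : ι × ι => p.2 < p.1) = A ×ˢ {a} :=
      Finset.filter_true_of_mem fun p hp => by
        obtain ⟨h1, h2⟩ := Finset.mem_product.1 hp
        rw [Finset.mem_singleton] at h2
        rw [h2]
        exact hmin p.1 (hA h1)
    rw [h1, Finset.card_product, Finset.card_singleton, mul_one]
  · exact Finset.disjoint_filter_filter
      (Finset.disjoint_product.2 (Or.inr (Finset.disjoint_singleton_left.2
        (fun h => haS (Finset.mem_sdiff.1 h).1))))

/-- **`(ψ+η)(ξ₁)⋯(ψ+η)(ξ_ℓ)` multiplied out** (121): `F⁺(θ_S) = Σ_{A ⊆ S} (−1)^{splitSign S A} ψ(A)η(S∖A)` — *"in the first line we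
multiply out the product and in each of the `2^ℓ` terms move all the `ψ(ξ_i)` to the left"*. [cite: DimockYuan2024GNFlow, §2.3 Lemma 9, proof (121) p.19 L23–62] -/
theorem shift_grassmannBasis (S : Finset ι) :
    shift (𝕜 := 𝕜) (grassmannBasis 𝕜 ι S) =
      ∑ A ∈ S.powerset, ((-1 : 𝕜) ^ splitSign S A) • grassmannBasis 𝕜 (ι ⊕ₗ ι) (split S A) := by
  classical
  induction S using Finset.induction_on_min with
  | empty =>
    rw [Finset.powerset_empty, Finset.sum_singleton, grassmannBasis_empty, map_one]
    simp [splitSign, split]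
  | insert a S hmin ih =>
    have haS : a ∉ S := fun h => lt_irrefl a (hmin a h)
    rw [grassmannBasis_insert_of_forall_lt 𝕜 hmin, map_mul, ih, shift_gen, Finset.mul_sum, Finset.powerset_insert,
      Finset.sum_union]
    · -- the `ψ(a)`-terms give `A ↦ insert a A`, the `η(a)`-terms keep `A`
      rw [Finset.sum_image (fun A hA B hB h => by
        rw [Finset.mem_coe, Finset.mem_powerset] at hA hB
        rw [← Finset.erase_insert (fun h' => haS (hA h')), h, Finset.erase_insert (fun h' => haS (hB h'))])]
      rw [← Finset.sum_add_distrib]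
      refine Finset.sum_congr rfl fun A hA => ?_
      rw [Finset.mem_powerset] at hA
      rw [mul_smul_comm, add_mul, gen_inl_mul_split hA hmin, gen_inr_mul_split hA hmin, smul_add, smul_smul,
        splitSign_insert_insert hA hmin, splitSign_insert hA hmin, pow_add, add_comm]
    · rw [Finset.disjoint_left]
      intro A hA hA'
      rw [Finset.mem_image] at hA'
      obtain ⟨B, _, rfl⟩ := hA'
      exact haS (Finset.mem_powerset.1 hA (Finset.mem_insert_self a B))


end Expansion

/-! ## The coefficients of `F⁺` and LEMMA 9 -/

/-- Membership in the first block. [folklore] -/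
private theorem mem_fstPart' {T : Finset (ι ⊕ₗ ι)} {a : ι} : a ∈ fstPart T ↔ toLex (Sum.inl a) ∈ T := by
  simp [fstPart]

/-- Membership in the second block. [folklore] -/
private theorem mem_sndPart' {T : Finset (ι ⊕ₗ ι)} {b : ι} : b ∈ sndPart T ↔ toLex (Sum.inr b) ∈ T := by
  simp [sndPart]

/-- The `ψ`-letters of `ψ(A)η(S∖A)` are `A`. [cite: DimockYuan2024GNFlow, §2.3 Lemma 9, proof (121) p.19 L23–62] -/
theorem fstPart_split (S A : Finset ι) : fstPart (split S A) = A := by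
  ext a
  rw [mem_fstPart', mem_split]
  constructor
  · rintro (⟨x, hx, hxe⟩ | ⟨y, _, hye⟩)
    · have : x = a := by simpa using hxe
      exact this ▸ hx
    · simp at hye
  · exact fun ha => Or.inl ⟨a, ha, rfl⟩

/-- The `η`-letters of `ψ(A)η(S∖A)` are `S ∖ A`. [cite: DimockYuan2024GNFlow, §2.3 Lemma 9, proof (121) p.19 L23–62] -/
theorem sndPart_split (S A : Finset ι) : sndPart (split S A) = S \ A := by
  ext b
  rw [mem_sndPart', mem_split]
  constructor
  · rintro (⟨x, _, hxe⟩ | ⟨y, hy, hye⟩)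
    · simp at hxe
    · have : y = b := by simpa using hye
      exact this ▸ hy
  · exact fun hb => Or.inr ⟨b, hb, rfl⟩

/-- A monomial of `Λ(ι ⊕ₗ ι)` whose `ψ`- and `η`-letters are disjoint is a term of a multiplied-out product. [cite: DimockYuan2024GNFlow, §2.3 Lemma 9, proof (121) p.19 L23–62] -/
theorem split_fstPart_union_sndPart {T : Finset (ι ⊕ₗ ι)} (hT : Disjoint (fstPart T) (sndPart T)) :
    split (fstPart T ∪ sndPart T) (fstPart T) = T := by
  ext w
  rw [mem_split]
  have hsd : (fstPart T ∪ sndPart T) \ fstPart T = sndPart T := by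
    rw [Finset.union_sdiff_left, Finset.sdiff_eq_self_iff_disjoint]
    exact hT.symm
  rw [hsd]
  obtain ⟨w, rfl⟩ := toLex.surjective w
  rcases w with a | b
  · constructor
    · rintro (⟨x, hx, hxe⟩ | ⟨y, _, hye⟩)
      · have : x = a := by simpa using hxe
        exact mem_fstPart'.1 (this ▸ hx)
      · simp at hye
    · exact fun h => Or.inl ⟨a, mem_fstPart'.2 h, rfl⟩
  · constructor
    · rintro (⟨x, _, hxe⟩ | ⟨y, hy, hye⟩)
      · simp at hxe
      · have : y = b := by simpa using hye
        exact mem_sndPart'.1 (this ▸ hy)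
    · exact fun h => Or.inr ⟨b, mem_sndPart'.2 h, rfl⟩

/-- `ψ(A)η(S∖A) = θ_T` pins down `A` (the `ψ`-letters of `T`) and `S` (all letters of `T`). [cite: DimockYuan2024GNFlow, §2.3 Lemma 9, proof (121) p.19 L23–62] -/
theorem split_eq_iff {S A : Finset ι} (hA : A ⊆ S) {T : Finset (ι ⊕ₗ ι)} :
    split S A = T ↔ Disjoint (fstPart T) (sndPart T) ∧ A = fstPart T ∧ S = fstPart T ∪ sndPart T := by
  constructor
  · rintro rfl
    rw [fstPart_split, sndPart_split]
    exact ⟨Finset.disjoint_sdiff, rfl, (Finset.union_sdiff_of_subset hA).symm⟩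
  · rintro ⟨hT, rfl, rfl⟩
    exact split_fstPart_union_sndPart hT

/-- **The coefficients of `F⁺`**: `c_T(F⁺) = (−1)^{splitSign (A∪B) A} c_{A ∪ B}(F)` if the `ψ`-letters `A` and the `η`-letters `B`
of `T` are disjoint, and `0` otherwise — the kernel identity (122) `F⁺_{n,m}(ξ₁…ξ_n,ζ₁…ζ_m) = F_{n+m}(ξ₁…ξ_n,ζ₁…ζ_m)` read in
the monomial basis. [cite: DimockYuan2024GNFlow, §2.3 Lemma 9, proof (122)–(123) p.19 L62–80] -/
theorem coeff_shift (F : GrassmannAlgebra 𝕜 ι) (T : Finset (ι ⊕ₗ ι)) :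
    coeff (shift F) T =
      if Disjoint (fstPart T) (sndPart T) then
        (-1 : 𝕜) ^ splitSign (fstPart T ∪ sndPart T) (fstPart T) * coeff F (fstPart T ∪ sndPart T)
      else 0 := by
  classical
  have hF : F = ∑ S, coeff F S • grassmannBasis 𝕜 ι S := ((grassmannBasis 𝕜 ι).sum_repr F).symm
  have hexp : coeff (shift F) T =
      ∑ S, ∑ A ∈ S.powerset, if split S A = T then coeff F S * (-1 : 𝕜) ^ splitSign S A else 0 := by
    conv_lhs => rw [hF]
    simp only [map_sum, map_smul, shift_grassmannBasis, Finset.smul_sum, smul_smul, coeff, Module.Basis.repr_self,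
      Finsupp.coe_finsetSum, Finset.sum_apply, Finsupp.smul_apply, smul_eq_mul]
    refine Finset.sum_congr rfl fun S _ => Finset.sum_congr rfl fun A _ => ?_
    rw [Finsupp.single_apply]
    split_ifs <;> simp
  rw [hexp]
  -- the inner sum: at most the term `A = fstPart T`
  have hinner : ∀ S : Finset ι, ∑ A ∈ S.powerset, (if split S A = T then coeff F S * (-1 : 𝕜) ^ splitSign S A else 0) =
      if Disjoint (fstPart T) (sndPart T) ∧ S = fstPart T ∪ sndPart T then
        coeff F S * (-1 : 𝕜) ^ splitSign S (fstPart T) else 0 := by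
    intro S
    split_ifs with hS
    · obtain ⟨hT, rfl⟩ := hS
      rw [Finset.sum_eq_single_of_mem (fstPart T) (Finset.mem_powerset.2 Finset.subset_union_left)]
      · rw [if_pos (split_fstPart_union_sndPart hT)]
      · intro A hA hne
        rw [if_neg]
        intro h
        exact hne ((split_eq_iff (Finset.mem_powerset.1 hA)).1 h).2.1
    · refine Finset.sum_eq_zero fun A hA => ?_
      rw [if_neg]
      intro h
      obtain ⟨hT, -, hS'⟩ := (split_eq_iff (Finset.mem_powerset.1 hA)).1 h
      exact hS ⟨hT, hS'⟩
  simp only [hinner]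
  split_ifs with hT
  · rw [Finset.sum_eq_single (fstPart T ∪ sndPart T)]
    · rw [if_pos ⟨hT, rfl⟩, mul_comm]
    · intro S _ hS
      rw [if_neg fun h => hS h.2]
    · intro h; exact absurd (Finset.mem_univ _) h
  · exact Finset.sum_eq_zero fun S _ => if_neg fun h => hT h.1

/-- `|c_T(F⁺)| = |c_{A∪B}(F)|` for disjoint blocks `A, B` of `T`, else `0` — *"make the same permutation in the kernel and the signs
cancel"*. [cite: DimockYuan2024GNFlow, §2.3 Lemma 9, proof (122)–(123) p.19 L62–80] -/
theorem norm_coeff_shift (F : GrassmannAlgebra 𝕜 ι) (T : Finset (ι ⊕ₗ ι)) :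
    ‖coeff (shift F) T‖ = if Disjoint (fstPart T) (sndPart T) then ‖coeff F (fstPart T ∪ sndPart T)‖ else 0 := by
  rw [coeff_shift]
  split_ifs
  · rw [norm_mul, norm_pow, norm_neg, norm_one, one_pow, one_mul]
  · exact norm_zero

/-- **LEMMA 9** (120): *"If `F⁺(ψ,η) = F(ψ+η)` then `‖F⁺‖_{h,h′} = ‖F‖_{h+h′}`"* — here for every real `h, h′`: by `norm_coeff_shift`
the left side is `Σ_{A ∩ B = ∅} h^{#A}h′^{#B}|c_{A∪B}(F)| = Σ_S |c_S(F)| Σ_{A⊆S} h^{#A}h′^{#S−#A} = Σ_S (h+h′)^{#S}|c_S(F)|` (the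
binomial theorem; the printed (123) is the same count `ℓ!/(n!m!)` of *"start positions"*). [cite: DimockYuan2024GNFlow, §2.3 Lemma 9 (120) p.19 L20–22] -/
theorem hNorm₂_shift (h h' : ℝ) (F : GrassmannAlgebra 𝕜 ι) : hNorm₂ h h' (shift F) = hNorm (h + h') F := by
  classical
  -- the right side, multiplied out by the binomial theorem: `(h+h′)^{#S} = Σ_{A ⊆ S} h^{#A} h′^{#S−#A}`
  have hR : hNorm (h + h') F = ∑ p ∈ (Finset.univ ×ˢ Finset.univ).filter (fun p : Finset ι × Finset ι => p.2 ⊆ p.1),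
      h ^ p.2.card * h' ^ (p.1.card - p.2.card) * ‖coeff F p.1‖ := by
    unfold hNorm
    rw [Finset.sum_filter, Finset.sum_product]
    refine Finset.sum_congr rfl fun S _ => ?_
    rw [← Finset.sum_pow_mul_eq_add_pow, Finset.sum_mul]
    have hpow : S.powerset = Finset.univ.filter (fun A : Finset ι => A ⊆ S) := by
      ext A; simp
    rw [hpow, Finset.sum_filter]
  -- the left side: only the `T` with disjoint parts
  have hL : hNorm₂ h h' (shift F) = ∑ T ∈ Finset.univ.filter (fun T : Finset (ι ⊕ₗ ι) => Disjoint (fstPart T) (sndPart T)),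
      h ^ (fstPart T).card * h' ^ (sndPart T).card * ‖coeff F (fstPart T ∪ sndPart T)‖ := by
    unfold hNorm₂
    rw [Finset.sum_filter]
    refine Finset.sum_congr rfl fun T _ => ?_
    rw [norm_coeff_shift]
    split_ifs <;> simp
  rw [hL, hR]
  -- the bijection `T ↦ (A ∪ B, A)`, `(S, A) ↦ split S A`
  refine Finset.sum_nbij' (fun T => (fstPart T ∪ sndPart T, fstPart T)) (fun p => split p.1 p.2) ?_ ?_ ?_ ?_ ?_
  · intro T _
    simp only [Finset.mem_filter, Finset.mem_product, Finset.mem_univ, true_and]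
    exact Finset.subset_union_left
  · intro p hp
    simp only [Finset.mem_filter, Finset.mem_univ, true_and]
    rw [fstPart_split, sndPart_split]
    exact Finset.disjoint_sdiff
  · intro T hT
    exact split_fstPart_union_sndPart (Finset.mem_filter.1 hT).2
  · intro p hp
    have hp' : p.2 ⊆ p.1 := (Finset.mem_filter.1 hp).2
    simp only [fstPart_split, sndPart_split, Finset.union_sdiff_of_subset hp']
  · intro T hT
    have hd : Disjoint (fstPart T) (sndPart T) := (Finset.mem_filter.1 hT).2
    simp only [Finset.card_union_of_disjoint hd, Nat.add_sub_cancel_left]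

end FieldTranslationNorm

end Literature.MathematicalPhysics.QuantumFieldTheory.DimockYuan2024
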